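import Summits.ABC.ABC.Theses.DefiniteXi
import Literature.NumberTheory.Automorphic.BCDTModularity
import Literature.NumberTheory.Automorphic.BCDTTheoremB
import Literature.NumberTheory.Automorphic.ThorneQInfinityModularTheorem2Proofs
import Literature.NumberTheory.EllipticCurves.ModThreeImageCubeDiscriminantProofs
import Literature.NumberTheory.EllipticCurves.SemistableModPImageIrreducibleProofs
import Literature.NumberTheory.EllipticCurves.SerreOpenImageDeterminantProofs
import Literature.NumberTheory.EllipticCurves.ThreeTorsionRadicalProofs
import Literature.NumberTheory.EllipticCurves.DivisionFieldDegreeProofs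
import Literature.NumberTheory.GaloisRepresentations.GL2F3Lift
import Mathlib.FieldTheory.KummerPolynomial
import Mathlib.GroupTheory.PGroup
import HarnessLib

/-!
# Stub ideas for `stub_modThree` — ideator k = 3, GENERATION 14 (home family 3: probe the extremes)

Typed companion of `STUB-IDEAS-stub_modThree-3.md` (gen 14).  Nothing here is registered; the
skeleton `Lines/Sketch.lean` is untouched.  This file has NO `sorry`.

**Trigger consumed.**  `Hecke_functionalEquation_infinityType_conductor_holds` LANDED
(`HeckeGrossencharakterFunctionalEquationConductorProofs`, 2026-09-01), so the 2-group half of the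
stub (`TwoGroupBranch`, ideator k1) no longer owes a named fact: the stub as typed is now
`SigStubModThreeSurj` (Tunnell's octahedral case, FROZEN on the Langlands–Tunnell leaves) modulo
prover work only.  Gen 14 probes the two EXTREMES of that frozen region:

* **(A) its boundary.**  For `E/ℚ` with irreducible `ρ̄_{E,3}` the two halves are separated by an
  ARITHMETIC predicate: `ρ̄_{E,3}(Γ_ℚ)` is a `2`-group **iff `Δ(E)` is a rational cube** (iff
  `j(E)` is a cube).  Both directions are PROVED here from the tree
  (`isPGroup_two_iff_exists_Δ_eq_cube`): `⇒` is Serre's `ℚ(E[3]) ⊇ ℚ(∛Δ)` (G1, any number field)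
  through the new frame transport `card_range_eq_of_isTorsionGaloisRep` (T1: `#ρ̄(Γ) = #ρ̄_{E,3}(Γ)`
  for every framed model — equal kernels); `⇐` is the tree's
  `ModThreeImage.not_hasSurjectiveModNGaloisRep_three_of_Δ_eq_cube` + Serre's Prop. 15
  (`not_dvd_card_of_not_hasSurjectiveModNGaloisRep`) + `|GL₂(𝔽₃)| = 48`.  Consequences:
  the dispatch `stub ⇐ F‴ ∧ CubeBranch` is kernel-checked WITHOUT the oddness / `N1` bricks
  (`stubModThree_of_surj_of_cube`), `TwoGroupBranch ↔ CubeBranch`, and the tree gains the converse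
  it records as missing in `ModThreeImageCubeDiscriminantProofs` («image in `N_ns(3)` ⟹ `j` is a
  cube»): `exists_j_eq_cube_of_not_three_dvd_card` (Zywina 2015 Thm 1.2, `ℓ = 3`, «only if», in
  image-size form, any number field).
* **(B) perturbation from the proved neighbour** (structural verdict, §3): no congruence moves a
  curve across the boundary without paying Faltings — every LT-free door out of the surjective
  region is a curve of genus `≥ 3` depending on `E` (closed forms + values below), except the
  `ℓ = 2` doors (genus `0`/`1`), which the gen-13 `Φ₂`-propagation barrier closes; and over
  `K₃ = ℚ(∛Δ)` EVERY curve sits in the neighbour's configuration (`Δ ∈ K₃³`, the tree's cube theorem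
  base-changed by `map_Δ`), so the return ticket to `ℚ` is exactly Tunnell's non-normal cubic
  descent — the freeze of F‴ is structural, not an artefact of the typing.
* **(C)** (optional, only if the lead keeps the `∀`-form of the 2-group half): at the line's
  use-site (`IsAbsIrreducibleOverSqrt (-3)`), a `2`-group image is a full `2`-Sylow (`16` elements,
  `N_ns(3)`); typed as `SigCardSixteenOfAbsIrrSqrt`, not proved.
-/

set_option linter.dupNamespace false

noncomputable section

open scoped MatrixGroups NumberField IntermediateField Polynomial
open NumberField IsDedekindDomain Field Polynomial
open Literature.NumberTheory.EllipticCurves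
open Literature.NumberTheory.EllipticCurves.ModThreeImage
open Literature.NumberTheory.Automorphic
open Literature.NumberTheory.Automorphic.BCDT
open Literature.NumberTheory.GaloisRepresentations
open WeierstrassCurve Matrix

namespace Summit.ABC.ABC.Cruxes.FreyModularity.StubIdeasModThree3G14

/-! ## §0 The registered stub, its two halves, and the arithmetic re-indexing of the 2-group half -/

/-- The statement of `stub_modThree` (verbatim, `Lines/Sketch.lean` l.143). -/
abbrev SigStubModThree : Prop :=
  ∀ (W : WeierstrassCurve ℚ) [W.IsElliptic] (ρ : ModPGaloisRep ℚ (ZMod 3) 2),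
    W.IsTorsionGaloisRep 3 ρ → FramedRep.IsAbsolutelyIrreducible ρ → ρ.IsModular

/-- **F‴ — the stub at SURJECTIVE `ρ̄` only** (Tunnell 1981, octahedral case; verbatim k1's
`StubModThreeSurj`, k3-g12's `SigStubModThreeSurj`).  FROZEN: blocked-on the Langlands–Tunnell
leaves. [cite: Tunnell1981] -/
abbrev SigStubModThreeSurj : Prop :=
  ∀ (W : WeierstrassCurve ℚ) [W.IsElliptic] (ρ : ModPGaloisRep ℚ (ZMod 3) 2),
    W.IsTorsionGaloisRep 3 ρ → Function.Surjective ρ → ρ.IsModular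

/-- The 2-group half (verbatim k1-g10 `TwoGroupBranch`; nameless since 2026-09-01 modulo k1's
E0–E5 bricks). [cite: Shimura1972ClassFields, Thm. 1] -/
abbrev TwoGroupBranch : Prop :=
  ∀ (W : WeierstrassCurve ℚ) [W.IsElliptic] (ρ : ModPGaloisRep ℚ (ZMod 3) 2),
    W.IsTorsionGaloisRep 3 ρ → FramedRep.IsAbsolutelyIrreducible ρ →
    IsPGroup 2 ρ.toMonoidHom.range → ρ.IsModular

/-- **The 2-group half re-indexed by its arithmetic boundary**: the same statement on the curves
whose discriminant is a rational cube (equivalently `j ∈ ℚ³`; Zywina's `X_{N_ns(3)}`: `j = t³`).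
`TwoGroupBranch ↔ CubeBranch` is `twoGroupBranch_iff_cubeBranch` below. [cite: Zywina2015, Thm. 1.2] -/
abbrev CubeBranch : Prop :=
  ∀ (W : WeierstrassCurve ℚ) [W.IsElliptic] (ρ : ModPGaloisRep ℚ (ZMod 3) 2),
    W.IsTorsionGaloisRep 3 ρ → FramedRep.IsAbsolutelyIrreducible ρ →
    (∃ d : ℚ, W.Δ = d ^ 3) → ρ.IsModular

/-! ## §1 Technique A — the boundary of the frozen region is the cube-discriminant locus -/

/-- **T1 (frame transport of the kernel)**: a framed model `ρ` of `E[N]` and the intrinsic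
`ρ̄_{E,N} : Γ_F → Aut E[N]` have the same kernel. [cite: SilvermanAEC2009, §III.7] -/
theorem ker_toMonoidHom_eq_ker_galoisRepTorsion {F : Type} [Field F] (W : WeierstrassCurve F)
    {N : ℕ} {ρ : FramedGaloisRep F (ZMod N) 2} (hρ : W.IsTorsionGaloisRep N ρ) :
    ρ.toMonoidHom.ker = (W.galoisRepTorsion (N : ℤ)).ker := by
  obtain ⟨e, he⟩ := hρ
  ext σ
  simp only [MonoidHom.mem_ker]
  constructor
  · intro h
    have h1 : (ρ σ : GL (Fin 2) (ZMod N)) = 1 := h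
    apply Multiplicative.toAdd.injective
    refine AddEquiv.ext fun P ↦ e.injective ?_
    rw [galoisRepTorsion_apply, he σ P, h1, toAdd_one, AddAut.zero_apply,
      Matrix.GeneralLinearGroup.coe_one, Matrix.one_mulVec]
  · intro h
    have hP : ∀ P : geomTorsion W (N : ℤ), σ • P = P := fun P ↦ by
      rw [← galoisRepTorsion_apply W (N : ℤ) σ P, h, toAdd_one, AddAut.zero_apply]
    have hv : ∀ v : Fin 2 → ZMod N,
        ((ρ σ : GL (Fin 2) (ZMod N)) : Matrix (Fin 2) (Fin 2) (ZMod N)) *ᵥ v =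
          ((1 : GL (Fin 2) (ZMod N)) : Matrix (Fin 2) (Fin 2) (ZMod N)) *ᵥ v := fun v ↦ by
      obtain ⟨P, rfl⟩ := e.surjective v
      rw [← he σ P, hP P, Matrix.GeneralLinearGroup.coe_one, Matrix.one_mulVec]
    show ρ σ = 1
    refine Units.ext (Matrix.ext fun i i' ↦ ?_)
    have := congrFun (hv (Pi.single i' 1)) i
    rwa [Matrix.mulVec_single_one, Matrix.mulVec_single_one] at this

/-- **T1 (frame transport of the image size)**: `#ρ(Γ_F) = #ρ̄_{E,N}(Γ_F)` for every framed model
`ρ` of `E[N]` (both are the index of the common kernel). [cite: SilvermanAEC2009, §III.7] -/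
theorem card_range_eq_of_isTorsionGaloisRep {F : Type} [Field F] (W : WeierstrassCurve F)
    {N : ℕ} {ρ : FramedGaloisRep F (ZMod N) 2} (hρ : W.IsTorsionGaloisRep N ρ) :
    Nat.card ρ.toMonoidHom.range = Nat.card (W.galoisRepTorsion (N : ℤ)).range := by
  rw [← Subgroup.index_ker, ← Subgroup.index_ker, ker_toMonoidHom_eq_ker_galoisRepTorsion W hρ]

/-- **G1 — `Δ ∉ K³ ⇒ 3 ∣ #ρ̄_{E,3}(Γ_K)`** (`K` a number field; Serre 1972 §5.3: `∛Δ ∈ K(x(E[3]))`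
by the tree's `zeta_mem_and_delta_mem_xDivisionField_three`, `ker ρ̄ ≤ Γ_{K(∛Δ)}`, Kummer).
Verbatim from the gen-12 companion (PROVED there and here). [cite: Serre1972, §5.3] -/
theorem three_dvd_card_range_galoisRepTorsion_of_Δ_ne_cube {K : Type} [Field K] [NumberField K]
    (W : WeierstrassCurve K) [W.IsElliptic] (hΔ : ∀ d : K, W.Δ ≠ d ^ 3) :
    3 ∣ Nat.card (W.galoisRepTorsion ((3 : ℕ) : ℤ)).range := by
  obtain ⟨ζ, δ, R₀, R₁, R₂, hζ, hδ, h₀, h₁, h₂, hR⟩ :=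
    (W.baseChange (AlgebraicClosure K)).exists_radical
  obtain ⟨-, ec₄, ec₆, eΔ⟩ := W.baseChange_algebraicClosure_invariants
  rw [eΔ] at hδ
  rw [ec₄] at h₀ h₁ h₂
  rw [ec₆] at hR
  have hδmem : δ ∈ W.xDivisionField 3 :=
    (W.zeta_mem_and_delta_mem_xDivisionField_three two_ne_zero three_ne_zero hζ hδ h₀ h₁ h₂
      hR).2
  have hker₁ : (W.galoisRepTorsion ((3 : ℕ) : ℤ)).ker ≤
      fixingSubgroupOfModule K (geomTorsion W ((3 : ℕ) : ℤ)) := by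
    intro σ hσ
    rw [mem_fixingSubgroupOfModule_geomTorsion_iff]
    intro T
    rw [← galoisRepTorsion_apply, MonoidHom.mem_ker.mp hσ]
    rfl
  have hker₂ : (W.galoisRepTorsion ((3 : ℕ) : ℤ)).ker ≤ (W.xDivisionField 3).fixingSubgroup := by
    rw [fixingSubgroup_xDivisionField]
    exact hker₁.trans (W.fixingSubgroupOfModule_le_xFixingSubgroup 3)
  have hle : K⟮δ⟯ ≤ W.xDivisionField 3 := IntermediateField.adjoin_simple_le_iff.mpr hδmem
  have hker₃ : (W.galoisRepTorsion ((3 : ℕ) : ℤ)).ker ≤ (K⟮δ⟯).fixingSubgroup :=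
    hker₂.trans (IntermediateField.fixingSubgroup_antitone hle)
  have hirr : Irreducible (X ^ 3 - C W.Δ : K[X]) :=
    X_pow_sub_C_irreducible_of_prime Nat.prime_three (fun b hb ↦ hΔ b hb.symm)
  have hint : IsIntegral K δ := Algebra.IsIntegral.isIntegral δ
  have hmin : minpoly K δ = X ^ 3 - C W.Δ := by
    refine (minpoly.eq_of_irreducible_of_monic hirr ?_ (monic_X_pow_sub_C _ three_ne_zero)).symm
    simp only [map_sub, map_pow, aeval_X, aeval_C, hδ, sub_self]
  have hdeg : Module.finrank K K⟮δ⟯ = 3 := by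
    rw [IntermediateField.adjoin.finrank hint, hmin, natDegree_X_pow_sub_C]
  have hdvd : Module.finrank K K⟮δ⟯ ∣ (W.galoisRepTorsion ((3 : ℕ) : ℤ)).ker.index := by
    rw [IntermediateField.finrank_eq_fixingSubgroup_index]
    exact Subgroup.index_dvd_of_le hker₃
  rw [← Subgroup.index_ker]
  exact hdeg ▸ hdvd

/-- `j = (c₄/d)³` when `Δ = d³` (`j = c₄³/Δ`). [cite: SilvermanAEC2009, III.1 (j = c₄³/Δ)] -/
theorem j_eq_cube_of_Δ_eq_cube {K : Type} [Field K] (W : WeierstrassCurve K) [W.IsElliptic]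
    {d : K} (hd : W.Δ = d ^ 3) : W.j = (W.c₄ / d) ^ 3 := by
  have hd0 : d ≠ 0 := by
    rintro rfl
    exact W.isUnit_Δ.ne_zero (by rw [hd]; ring)
  have hjΔ : W.j * W.Δ = W.c₄ ^ 3 := by
    rw [WeierstrassCurve.j, ← W.coe_Δ', mul_comm, ← mul_assoc, Units.mul_inv, one_mul]
  rw [div_pow, eq_div_iff (pow_ne_zero 3 hd0), ← hd]
  exact hjΔ

/-- **Zywina 2015, Thm. 1.2 (`ℓ = 3`, `G₄ = N_ns(3)`), the «ONLY IF» direction in image-size form —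
the converse recorded as missing in `ModThreeImageCubeDiscriminantProofs`**: over a number field
`K`, if `3 ∤ #ρ̄_{E,3}(Γ_K)` (i.e. the image lies in a `2`-Sylow `= N_ns(3)` up to conjugacy) then
`j(E)` is a cube in `K`.  PROVED (G1 + `j = c₄³/Δ`). [cite: Zywina2015, Thm. 1.2 (second item, i = 4)]
[cite: Serre1972, §5.3] -/
theorem exists_j_eq_cube_of_not_three_dvd_card {K : Type} [Field K] [NumberField K]
    (W : WeierstrassCurve K) [W.IsElliptic]
    (h : ¬ 3 ∣ Nat.card (W.galoisRepTorsion ((3 : ℕ) : ℤ)).range) : ∃ t : K, W.j = t ^ 3 := by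
  by_contra hj
  push Not at hj
  exact h (three_dvd_card_range_galoisRepTorsion_of_Δ_ne_cube W fun d hd ↦
    hj (W.c₄ / d) (j_eq_cube_of_Δ_eq_cube W hd))

/-- **G3′ — Serre's Prop. 15 for `E/ℚ`, image-size form**: `E[3]` irreducible and `ρ̄_{E,3}` not
onto ⇒ `3 ∤ #ρ̄_{E,3}(Γ_ℚ)` (tree: `not_dvd_card_of_not_hasSurjectiveModNGaloisRep` on the frame of
`exists_frame_galoisRepTorsion_rat`). PROVED. [cite: Serre1972, §2.4 Prop. 15; §5.4] -/
theorem not_three_dvd_card_of_not_hasSurjective (W : WeierstrassCurve ℚ) [W.IsElliptic]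
    (hirr : W.HasIrreducibleModPGaloisRep 3) (hns : ¬ W.HasSurjectiveModNGaloisRep 3) :
    ¬ 3 ∣ Nat.card (W.galoisRepTorsion ((3 : ℕ) : ℤ)).range := by
  haveI : Fact (Nat.Prime 3) := ⟨Nat.prime_three⟩
  obtain ⟨e, Φ, he, -⟩ := exists_frame_galoisRepTorsion_rat W 3
  have hns' : ¬ W.HasSurjectiveModNGaloisRep ((3 : ℕ) : ℤ) := by exact_mod_cast hns
  have key := not_dvd_card_of_not_hasSurjectiveModNGaloisRep W 3 Φ e he hirr hns'
  rwa [card_map_range_galoisRepTorsion W 3 Φ] at key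

/-- **H1 (⇒) — a `2`-group image forces a cube discriminant** (G1 + T1; no irreducibility, no
oddness needed). PROVED. [cite: Serre1972, §5.3] -/
theorem exists_Δ_eq_cube_of_isPGroup_two (W : WeierstrassCurve ℚ) [W.IsElliptic]
    {ρ : ModPGaloisRep ℚ (ZMod 3) 2} (hρ : W.IsTorsionGaloisRep 3 ρ)
    (h2 : IsPGroup 2 ρ.toMonoidHom.range) : ∃ d : ℚ, W.Δ = d ^ 3 := by
  by_contra hΔ
  push Not at hΔ
  have h3 : 3 ∣ Nat.card ρ.toMonoidHom.range := by
    rw [card_range_eq_of_isTorsionGaloisRep W hρ]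
    exact three_dvd_card_range_galoisRepTorsion_of_Δ_ne_cube W hΔ
  haveI : Fact (Nat.Prime 2) := ⟨Nat.prime_two⟩
  haveI : Finite (GL (Fin 2) (ZMod 3)) :=
    Nat.finite_of_card_ne_zero (by rw [GL2F3Lift.card_GL_fin_two_zmod_three]; norm_num)
  obtain ⟨k, hk⟩ := IsPGroup.iff_card.mp h2
  rw [hk] at h3
  have h32 : (3 : ℕ) = 2 :=
    (Nat.prime_dvd_prime_iff_eq Nat.prime_three Nat.prime_two).mp (Nat.prime_three.dvd_of_dvd_pow h3)
  exact absurd h32 (by norm_num)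

/-- **H1 (⇐) — a cube discriminant forces a `2`-group image** for irreducible `ρ̄_{E,3}`
(tree cube theorem + G3′ + T1 + `|GL₂(𝔽₃)| = 48`). PROVED. [cite: Serre1972, §5.3–5.4] -/
theorem isPGroup_two_of_Δ_eq_cube (W : WeierstrassCurve ℚ) [W.IsElliptic]
    {ρ : ModPGaloisRep ℚ (ZMod 3) 2} (hρ : W.IsTorsionGaloisRep 3 ρ)
    (hirr : FramedRep.IsIrreducible ρ) {d : ℚ} (hd : W.Δ = d ^ 3) :
    IsPGroup 2 ρ.toMonoidHom.range := by
  haveI : Fact (Nat.Prime 3) := ⟨Nat.prime_three⟩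
  have hns : ¬ W.HasSurjectiveModNGaloisRep 3 :=
    not_hasSurjectiveModNGaloisRep_three_of_Δ_eq_cube W hd
  have hI : W.HasIrreducibleModPGaloisRep 3 :=
    Thorne2016.hasIrreducibleModPGaloisRep_of_isIrreducible hρ hirr
  have h3 : ¬ 3 ∣ Nat.card ρ.toMonoidHom.range := by
    rw [card_range_eq_of_isTorsionGaloisRep W hρ]
    exact not_three_dvd_card_of_not_hasSurjective W hI hns
  have h48 : Nat.card ρ.toMonoidHom.range ∣ 2 ^ 4 * 3 := by
    have h := Subgroup.card_subgroup_dvd_card ρ.toMonoidHom.range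
    rwa [GL2F3Lift.card_GL_fin_two_zmod_three] at h
  have h16 : Nat.card ρ.toMonoidHom.range ∣ 2 ^ 4 :=
    Nat.Coprime.dvd_of_dvd_mul_right
      ((Nat.Prime.coprime_iff_not_dvd Nat.prime_three).mpr h3).symm h48
  obtain ⟨k, -, hk⟩ := (Nat.dvd_prime_pow Nat.prime_two).1 h16
  exact IsPGroup.of_card hk

/-- **The boundary theorem**: for `E/ℚ` and an irreducible framed `ρ̄_{E,3}`,
`ρ̄(Γ_ℚ)` is a `2`-group **iff** `Δ(E) ∈ ℚ³`. PROVED. [cite: Serre1972, §5.3] [cite: Zywina2015, Thm. 1.2] -/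
theorem isPGroup_two_iff_exists_Δ_eq_cube (W : WeierstrassCurve ℚ) [W.IsElliptic]
    {ρ : ModPGaloisRep ℚ (ZMod 3) 2} (hρ : W.IsTorsionGaloisRep 3 ρ)
    (hirr : FramedRep.IsIrreducible ρ) :
    IsPGroup 2 ρ.toMonoidHom.range ↔ ∃ d : ℚ, W.Δ = d ^ 3 :=
  ⟨exists_Δ_eq_cube_of_isPGroup_two W hρ, fun ⟨_, hd⟩ ↦ isPGroup_two_of_Δ_eq_cube W hρ hirr hd⟩

/-- **Off the boundary every irreducible framed `ρ̄_{E,3}` is SURJECTIVE** (G1 + G3′ + the tree's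
frame transport `rep_surjective_of_hasSurjectiveModNGaloisRep`) — the all-`E` form of gen 12's
`surjective_of_isIrreducible_freyCurve_three`. PROVED. [cite: Serre1972, §5.3–5.4] -/
theorem surjective_of_forall_Δ_ne_cube (W : WeierstrassCurve ℚ) [W.IsElliptic]
    {ρ : ModPGaloisRep ℚ (ZMod 3) 2} (hρ : W.IsTorsionGaloisRep 3 ρ)
    (hirr : FramedRep.IsIrreducible ρ) (hΔ : ∀ d : ℚ, W.Δ ≠ d ^ 3) :
    Function.Surjective ρ := by
  haveI : Fact (Nat.Prime 3) := ⟨Nat.prime_three⟩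
  have hI : W.HasIrreducibleModPGaloisRep 3 :=
    Thorne2016.hasIrreducibleModPGaloisRep_of_isIrreducible hρ hirr
  have h3 := three_dvd_card_range_galoisRepTorsion_of_Δ_ne_cube W hΔ
  have hS : W.HasSurjectiveModNGaloisRep ((3 : ℕ) : ℤ) := by
    by_contra hns
    have hns' : ¬ W.HasSurjectiveModNGaloisRep 3 := by exact_mod_cast hns
    exact not_three_dvd_card_of_not_hasSurjective W hI hns' h3
  obtain ⟨e, he⟩ := hρ
  intro M
  obtain ⟨σ, hσ⟩ := rep_surjective_of_hasSurjectiveModNGaloisRep W e ρ.toMonoidHom he hS M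
  exact ⟨σ, hσ⟩

/-- **The arithmetic dichotomy** (frame-free index): an irreducible framed `ρ̄_{E,3}` is onto
`GL₂(𝔽₃)` or `Δ(E)` is a cube. PROVED. [cite: Serre1972, §5.3–5.4] -/
theorem surjective_or_exists_Δ_eq_cube (W : WeierstrassCurve ℚ) [W.IsElliptic]
    {ρ : ModPGaloisRep ℚ (ZMod 3) 2} (hρ : W.IsTorsionGaloisRep 3 ρ)
    (hirr : FramedRep.IsIrreducible ρ) :
    Function.Surjective ρ ∨ ∃ d : ℚ, W.Δ = d ^ 3 := by
  by_cases hc : ∃ d : ℚ, W.Δ = d ^ 3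
  · exact Or.inr hc
  · push Not at hc
    exact Or.inl (surjective_of_forall_Δ_ne_cube W hρ hirr hc)

/-! ## §2 Assembly — the stub from F‴ and the cube branch, with NO auxiliary hypotheses -/

/-- `CubeBranch ⇒ TwoGroupBranch` (H1 ⇒). [folklore] -/
theorem twoGroupBranch_of_cubeBranch (h : CubeBranch) : TwoGroupBranch :=
  fun W _ ρ hρ habs h2 ↦ h W ρ hρ habs (exists_Δ_eq_cube_of_isPGroup_two W hρ h2)

/-- `TwoGroupBranch ⇒ CubeBranch` (H1 ⇐). [folklore] -/
theorem cubeBranch_of_twoGroupBranch (h : TwoGroupBranch) : CubeBranch :=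
  fun W _ ρ hρ habs hc ↦ by
    obtain ⟨d, hd⟩ := hc
    exact h W ρ hρ habs (isPGroup_two_of_Δ_eq_cube W hρ habs.isIrreducible hd)

/-- **The two indexings of the 2-group half agree.** PROVED. [folklore] -/
theorem twoGroupBranch_iff_cubeBranch : TwoGroupBranch ↔ CubeBranch :=
  ⟨cubeBranch_of_twoGroupBranch, twoGroupBranch_of_cubeBranch⟩

/-- **★ The stub as typed = F‴ (octahedral, frozen) + the cube branch (nameless)** — kernel-checked
dispatch by the arithmetic predicate `∃ d, Δ = d³`; unlike k1's `stubModThree_of_surj_of_twoGroup`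
it needs neither `H0` (oddness) nor `N1`. [cite: Tunnell1981] [cite: Serre1972, §5.3] -/
theorem stubModThree_of_surj_of_cube (hS : SigStubModThreeSurj) (hC : CubeBranch) :
    SigStubModThree := by
  intro W _ ρ hρ habs
  rcases surjective_or_exists_Δ_eq_cube W hρ habs.isIrreducible with hs | hc
  · exact hS W ρ hρ hs
  · exact hC W ρ hρ habs hc

/-- … and with k1's indexing. [folklore] -/
theorem stubModThree_of_surj_of_twoGroup (hS : SigStubModThreeSurj) (hT : TwoGroupBranch) :
    SigStubModThree :=
  stubModThree_of_surj_of_cube hS (cubeBranch_of_twoGroupBranch hT)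

/-- Conversely the stub gives both halves (surjective ⇒ absolutely irreducible is the tree's
`isAbsIrreducibleOverSqrt_neg_three_of_surjective`). [folklore] -/
theorem surj_and_cube_of_stubModThree (h : SigStubModThree) : SigStubModThreeSurj ∧ CubeBranch :=
  ⟨fun W _ ρ hρ hs ↦
    h W ρ hρ (isAbsIrreducibleOverSqrt_neg_three_of_surjective ρ hs).isAbsolutelyIrreducible,
   fun W _ ρ hρ habs _ ↦ h W ρ hρ habs⟩

/-! ## §3 Technique B — perturbation from the proved neighbour: the doors and their genera

For `E/ℚ` with `ρ̄_{E,3}` onto, an LT-free proof of `ρ̄_{E,3}` modular must import modularity from a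
curve `E'` that is modular for a reason other than Langlands–Tunnell.  The doors:

* keep `E[3]` (`E' ∈ X_E(3) ≅ ℙ¹`, so `ρ̄_{E',3} ≅ ρ̄_{E,3}` and no lifting is needed) and ask `E'`
  to be LT-free modular: `E'` CM is impossible (surjective image); `E'` dihedral at a prime
  `ℓ ≥ 5` puts `(E, E')` on `X(3) ×_{X(1)} X_{ns}^+(ℓ)` of genus `1 + (ℓ-1)(ℓ-2)/2` (`7, 16` for
  `ℓ = 5, 7`) or on `X(3) ×_{X(1)} X_s^+(ℓ)` of genus `1 + (ℓ+1)(ℓ-2)/2` (`10, 21`); `E'` reducible at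
  `ℓ = 5, 7` (Skinner–Wiles): genus `3, 5`; the only genus-`0`/`1` doors are `X(3) × X₀(2)` (genus `0`)
  and `X(3) × X₀(4)` (genus `1`), i.e. reducible at `2`, where no residual-modularity input exists
  (gen-13 `Φ₂` barrier).  (Riemann–Hurwitz for the `A₄ = PSL₂(𝔽₃)`-cover of the base curve `B` of
  level prime to `3`: `2g - 2 = 2μ(B) - 4c(B)`, `μ` = degree over `X(1)`, `c` = number of cusps.)
* switch primes: `E'` with `E'[ℓ] ≅ E[ℓ]` and `E'` in the neighbour's configuration (`2`-group at
  `3`, i.e. `j(E') ∈ ℚ³`): `(E, E')` on `X_E(ℓ) ×_{X(1)} X_{ns}^+(3)`, genus `1 + (ℓ²-1)(ℓ-2)/8`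
  (`ℓ = 2, 5, 7, 11 ↦ 1, 10, 31, 136`); `ℓ = 2` is again closed by the `Φ₂` barrier (no `2`-adic
  lifting for the wild Frey core), `ℓ ≥ 5` is Faltings-finite per `E`.
* at `ℓ = 3` itself nothing moves: the image is an invariant of the pencil `X_E(3)`.

So every door is a curve of genus `≥ 3` depending on `E` (finitely many `E'`, generically none)
or is closed at `2`: the generic curve has NO LT-free neighbour.  And over `K₃ = ℚ(∛Δ)` every `E`
is in the neighbour's configuration (below), so the way back to `ℚ` is Tunnell's non-normal cubic
descent `K₃/ℚ` — precisely the Langlands–Tunnell leaf the freeze names. -/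

/-- Genus of the prime-switch door `X_E(ℓ) ×_{X(1)} X_{ns}^+(3)`. [folklore] -/
def switchDoorGenus (ℓ : ℕ) : ℕ := 1 + (ℓ ^ 2 - 1) * (ℓ - 2) / 8

/-- Genus of the keep-`E[3]` door `X(3) ×_{X(1)} X_{ns}^+(ℓ)`. [folklore] -/
def keepThreeNsDoorGenus (ℓ : ℕ) : ℕ := 1 + (ℓ - 1) * (ℓ - 2) / 2

/-- Genus of the keep-`E[3]` door `X(3) ×_{X(1)} X_s^+(ℓ)`. [folklore] -/
def keepThreeSDoorGenus (ℓ : ℕ) : ℕ := 1 + (ℓ + 1) * (ℓ - 2) / 2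

/-- Genus of the keep-`E[3]` door over a base of degree `μ` with `c` cusps (level prime to `3`):
`g = 1 + μ - 2c` (`X₀(2)`: `μ = 3, c = 2`; `X₀(4)`: `6, 3`; `X₀(5)`: `6, 2`; `X₀(7)`: `8, 2`). [folklore] -/
def keepThreeDoorGenus (μ c : ℕ) : ℕ := 1 + μ - 2 * c

example : switchDoorGenus 2 = 1 ∧ switchDoorGenus 5 = 10 ∧ switchDoorGenus 7 = 31 ∧
    switchDoorGenus 11 = 136 ∧ keepThreeNsDoorGenus 5 = 7 ∧ keepThreeNsDoorGenus 7 = 16 ∧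
    keepThreeSDoorGenus 5 = 10 ∧ keepThreeSDoorGenus 7 = 21 ∧ keepThreeDoorGenus 3 2 = 0 ∧
    keepThreeDoorGenus 6 3 = 1 ∧ keepThreeDoorGenus 6 2 = 3 ∧ keepThreeDoorGenus 8 2 = 5 := by
  decide

/-- **Over any field containing a cube root of `Δ(E)` the curve is in the neighbour's
configuration**: `ρ̄_{E,3}|_{Γ_K}` is not onto `Aut E[3]` (the tree's cube theorem, base-changed by
Mathlib's `map_Δ`).  With `K = K₃ = ℚ(∛Δ)` (degree `3`, non-normal when `Δ ∉ ℚ³`) this is the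
configuration Tunnell descends from. [cite: Serre1972, §5.3] [cite: Tunnell1981] -/
theorem not_hasSurjective_map_of_Δ_eq_cube {K : Type} [Field K] [CharZero K]
    (W : WeierstrassCurve ℚ) [W.IsElliptic] {d : K} (hd : algebraMap ℚ K W.Δ = d ^ 3) :
    ¬ (W.map (algebraMap ℚ K)).HasSurjectiveModNGaloisRep 3 :=
  not_hasSurjectiveModNGaloisRep_three_of_Δ_eq_cube (W.map (algebraMap ℚ K))
    (by rw [map_Δ]; exact hd)

/-! ## §4 (C) The use-site sharpening (typed only) -/

/-- **(C) At the line's use-site a `2`-group image is a full `2`-Sylow**: if `ρ̄|_{ℚ(√-3)}` is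
absolutely irreducible (the hypothesis under which `liftThree_of_stubs` consumes `stub_modThree`)
and `ρ̄(Γ_ℚ)` is a `2`-group, then `#ρ̄(Γ_ℚ) = 16` (`ρ̄(Γ_{ℚ(√-3)}) = ρ̄(Γ_ℚ) ∩ SL₂(𝔽₃)` is a
non-abelian `2`-subgroup of `SL₂(𝔽₃)`, hence `Q₈`; `det` is onto `{±1}`).  So only the `N_ns(3)`
curves ever reach the lifting step; `C₈`, `N_s(3) ≅ D₄`, `Q₈` images do not.  Size M (needs the
image of `restrictField` = `range ∩ ker det`).  Why it might fail: it does not — group theory in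
`SD₁₆`; cheapest falsifier: `32a2` (`j = 1728`, image `N_ns(3)` of order `16`). [cite: Serre1972, §2.6] -/
abbrev SigCardSixteenOfAbsIrrSqrt : Prop :=
  ∀ (W : WeierstrassCurve ℚ) [W.IsElliptic] (ρ : ModPGaloisRep ℚ (ZMod 3) 2),
    W.IsTorsionGaloisRep 3 ρ → ρ.IsAbsIrreducibleOverSqrt (-3) →
    IsPGroup 2 ρ.toMonoidHom.range → Nat.card ρ.toMonoidHom.range = 16

end Summit.ABC.ABC.Cruxes.FreyModularity.StubIdeasModThree3G14

end
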